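import Mathlib
import HarnessLib
import Summits.ValiantsHypothesis.ValiantsHypothesis.Theses.MonotoneRestoration
import Literature.Computability.AlgebraicComplexity.ArithCircuit
import Literature.Computability.AlgebraicComplexity.ArithCircuitProofs
import Literature.Computability.AlgebraicComplexity.MonotoneStructure
import Literature.Computability.AlgebraicComplexity.PermanentIrreducible
import Literature.ModelTheory.FiniteModelTheory.CkEquiv
import Summits.ValiantsHypothesis.ValiantsHypothesis.Theorems.MonotoneRestorationMonotoneRestorationQPCosetCount
import Summits.ValiantsHypothesis.ValiantsHypothesis.Theorems.MonotoneRestorationMonotoneRestorationQPSymmetricLB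
import Summits.ValiantsHypothesis.ValiantsHypothesis.Theorems.MonotoneRestorationMonotoneRestorationQPSupportSymmetrisation
import Summits.ValiantsHypothesis.ValiantsHypothesis.Theorems.MonotoneRestorationMonotoneRestorationQPSparseRegime
import Summits.ValiantsHypothesis.ValiantsHypothesis.Theorems.MonotoneRestorationMonotoneRestorationQPBeta
import Literature.Computability.AlgebraicComplexity.SymmetricArithCircuit
import Literature.Computability.AlgebraicComplexity.DawarWilsenach2025Proofs
import Literature.GroupTheory.PermutationGroups.SmallIndexSubgroups
import Summits.ValiantsHypothesis.ValiantsHypothesis.Theorems.MonotoneRestorationQP.Negative.LoadBearing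
import Summits.ValiantsHypothesis.ValiantsHypothesis.Theorems.MonotoneRestorationMonotoneRestorationQPPermSupportCount

/-! TTRL-lite variant V18993 of stmt-ValiantsHypothesis-15886 -/

-- `Summit.<Summit>.<Problem>` is the tree's mandated summit-side namespace (CONVENTIONS §2); for this
-- single-conjunct summit the two coincide, so the duplicate is deliberate.
set_option linter.dupNamespace false

namespace Summit.ValiantsHypothesis.ValiantsHypothesis.Theorems

open Summit.ValiantsHypothesis.ValiantsHypothesis.Theses.MonotoneRestoration
open Literature.Computability.AlgebraicComplexity

/-- **Variant V18993 of `stub_altFixing_orbit_dichotomy` (arithmetic kernel).**  For `m ≥ 3`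
one has `2 · (m-1)! < m!`: indeed `m! = m · (m-1)!` (`Nat.mul_factorial_pred`), `(m-1)! > 0`
and `2 < m`.  This is the counting step `|Alt(m)| = m!/2 > (m-1)!` behind the orbit dichotomy
(an orbit of `Alt(m)` of size `< m` is a point). [folklore] -/
theorem stub_altFixing_orbit_dichotomy_var18993 :
    ∀ (m : ℕ), 3 ≤ m → 2 * (m - 1).factorial < m.factorial := by
  intro m hm
  rw [← Nat.mul_factorial_pred (n := m) (by omega)]
  exact Nat.mul_lt_mul_of_pos_right (by omega) (Nat.factorial_pos _)

end Summit.ValiantsHypothesis.ValiantsHypothesis.Theorems
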